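import Summits.HodgeConjecture.HodgeConjecture.Theorems.HodgeLocusCensusUnitColumnRankLevelSymmetry
import Summits.HodgeConjecture.HodgeConjecture.Theorems.HodgeLocusCensusUnitColumnBetti
import Summits.HodgeConjecture.HodgeConjecture.Theorems.HodgeLocusCensusUnitColumnChain
/-!
# PROBE 31 — THE CENSUS HOMOLOGY `H_(c)(J) = leftker (×q^c at J) / rowspace (×q^(p−c) at j)`: THE OBJECT, ITS DIMENSION LAW, THE EXACTNESS
# CRITERION, ITS POINCARÉ DUALITY, AND THE `p`-SECTION INEQUALITY `S_p(m,T+c) ≤ S_p(m,T)` ON THE WINDOW (ENGINE B ivhs-2, HODGE-LOCUS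
# CENSUS CELL)

SETTING (anchors 229 `…UnitColumnRankLevelsPowers`, 312 `…UnitColumnRankLevelSymmetry`, 345 `…InclusionRankBetti`, 349 = PROBE 29
`…UnitColumnBetti`, 351 = PROBE 30 `…UnitColumnChain`).
`A = K[x_1..x_k]/(x_i^{e+2})`, `q = Σ x_i^{e+1}`, `char K = p` prime, `0 < c < p`, codegrees `j` and `J = j + (p−c)(e+1)`; anchor 229's
multiplicity matrices `M_(p−c)(j → J)` and `M_c(J → J + c(e+1))` VERBATIM (the texts of PROBE 29's census Betti law).  PROBE 30 (CX-range):
`rowspace M_(p−c) ≤ leftker M_c` (`q^(p−c) · q^c = q^p = 0`); PROBE 29 (CENSUS BETTI): `dim leftker M_c + Σ_μ [feasible ∧ window] S_p(k−s,t+c)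
= dim rowspace M_(p−c) + Σ_μ [feasible ∧ window] S_p(k−s,t)` (label sum over `μ : Fin k → Fin (e+1)`, `s = #{μ ≠ 0}`,
`t = (J + Σμ)/(e+1) − s`, window `2t ≤ k−s+(p−c) ∧ k−s < 2t+c`, `S_p(n,x) = Σ_{y ≤ n, y ≡ x (p)} C(n,y)` in three pieces).

CONTENT (this file; nothing assumed, every item a theorem over the cited anchors):
 §1 (B-MONO) `wilson_section_le` — for a prime `p > c ≥ 1` and `T + c ≤ m`, `p − c ≤ T`, `2T ≤ m + (p−c)`, `m ≤ 2T + c`: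
     `S_p(m, T+c) ≤ S_p(m, T)` (both in pieces).  A statement about binomial coefficients alone, proved by LINEAR ALGEBRA over `ZMod p`:
     anchor 345 (B-cx) `rowspace W_{T−(p−c),T} ≤ leftker W_{T,T+c}` gives `dim rowspace ≤ dim leftker`, and 345 (B-hom) converts the two
     dimensions into the two sections.  (It is the non-negativity of the block homology; dropping either window inequality makes it false.)
 §2 THE CENSUS HOMOLOGY at `(c, J)`:
     (CX-J)   `range_le_ker` — PROBE 30 (CX-range) at `(a, b) = (p−c, c)`: `rowspace M_(p−c)(j→J) ≤ leftker M_c(J→J+c(e+1))`, typed on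
              PROBE 29's matrix texts; `finrank_range_le_finrank_ker` its dimension shadow.
     (HOM)    `finrank_homology_add_eq` — THE DIMENSION LAW of the homology MODULE
              `H = leftker M_c ⧸ (rowspace M_(p−c) pulled back along the inclusion of leftker M_c)`:
              `dim_K H + Σ_μ [feasible ∧ window] S_p(k−s,t+c) = Σ_μ [feasible ∧ window] S_p(k−s,t)`
              (`Submodule.finrank_quotient_add_finrank`, `Submodule.comapSubtypeEquivOfLe` on (CX-J), PROBE 29).
     (EX-iff) `range_eq_ker_iff` — EXACTNESS CRITERION: `rowspace M_(p−c) = leftker M_c ↔ Σ_μ [f ∧ w] S_p(k−s,t+c) = Σ_μ [f ∧ w] S_p(k−s,t)`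
              (`Submodule.eq_of_le_of_finrank_eq` on (CX-J) and PROBE 29; the converse by `LinearEquiv.ofEq`).
     (EX-off) `range_eq_ker_of_forall_not_window` — if NO feasible label has its block in the window, the census ladder is EXACT at `J`:
              `rowspace M_(p−c)(j→J) = leftker M_c(J→J+c(e+1))` (both label sums vanish termwise).  This is the census-level form of
              anchor 340 (EX-ker) (there: one block, below the middle), now at every codegree and on both sides of the window band.

 §3 (PD) POINCARÉ DUALITY `finrank_homology_eq_dual` — for complementary levels `j + j' + p(e+1) = k(e+1)` (`J + J' = k(e+1)`,
     `J' = j' + c(e+1)`): `dim_K H_(c)(J) = dim_K ( leftker M_(p−c)(J'→J'+(p−c)(e+1)) ⧸ rowspace M_c(j'→J') )` — the homology of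
     `(q^(p−c), q^c)` at `J` and of `(q^c, q^(p−c))` at the dual codegree are equidimensional: rank–nullity, anchor 312 (SYM-F)
     `rank_levels_symm_field` on both ranks, and `card_level_eq_card_level` (`#{codeg J} = #{codeg J'}` by `v ↦ top − v`, PROBE 30
     `degree_dual_add_degree`).  Anchor 312 had the rank shadow «without any duality»; PROBE 30 (DUAL) the transpose law; this is the
     statement for the homology itself (in dimension).

PROVENANCE.  ENGINE B ivhs-2 g58 (HODGE-LOCUS CENSUS CELL).  Imports by name: anchor 349 = PROBE 29 `…HodgeLocusCensusUnitColumnBetti`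
(census Betti law, `finrank_range_vecMulLinear_eq_rank`; it imports anchor 345), anchor 351 = PROBE 30 `…HodgeLocusCensusUnitColumnChain` (complex,
`degree_dual_add_degree`; it imports anchor 229) and anchor 312 `…HodgeLocusCensusUnitColumnRankLevelSymmetry` (`rank_levels_symm_field`).  Mathlib by name:
`Submodule.finrank_mono`, `Submodule.finrank_quotient_add_finrank`, `Submodule.comapSubtypeEquivOfLe`, `LinearEquiv.finrank_eq`,
`LinearEquiv.ofEq`, `Submodule.eq_of_le_of_finrank_eq`, `LinearMap.finrank_range_add_finrank_ker`, `Module.finrank_fintype_fun_eq_card`,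
`Fintype.card_congr`, `Fintype.card_fin`, `Fin.rev` / `Fin.rev_rev`, `Nat.sub_mul`, `ZMod` (`ZMod.charP`, `Fact`).  No `sorry`, no new axiom, no
`def`, no instance/notation/attribute manipulation; `set_option` = the two below.  LITERATURE (context only; nothing imported or minted):
the `N`-complex homologies `ker d^c / im d^(N−c)` of a differential with `d^N = 0` (M. M. Kapranov, «On the q-analog of homological
algebra», arXiv:q-alg/9611005; M. Dubois-Violette, «d^N = 0: generalized homology», K-Theory 14 (1998) 371–404, doi:10.1023/a:1007786403736)
— here `d = ×q`, `N = p`; the block value `S_p(m,T) − S_p(m,T+c)` is the one of V. B. Mnukhin & J. Siemons, J. Combin. Theory Ser. A 74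
(1996) 287–300, doi:10.1006/jcta.1996.0051, Thm 5.3 (cited in anchors 340/345).  No literature fact is used as a hypothesis.
certified instances and evidence bearing on the general Hodge conjecture; no claim.
-/

set_option linter.dupNamespace false
set_option autoImplicit false

namespace Summit.HodgeConjecture.HodgeConjecture.HodgeLocus.Census.UnitColumnHomology

open Summit.HodgeConjecture.HodgeConjecture.HodgeLocus.Census.ModelNonJumpC1All (colR)

/-! ## §1 (B-MONO): the `p`-section inequality on the window, by linear algebra over `ZMod p` -/

/-- **(B-MONO)** for a prime `p > c ≥ 1`, `T + c ≤ m`, `p − c ≤ T` and the closed window `2T ≤ m + (p−c)`, `m ≤ 2T + c`: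
`S_p(m, T+c) ≤ S_p(m, T)`, i.e. `Σ_{b<(T+c)/p} C(m,T+c−(b+1)p) + C(m,T+c) + Σ_{b<(m−T−c)/p} C(m,T+c+(b+1)p) ≤ Σ_{b<T/p} C(m,T−(b+1)p) + C(m,T)
+ Σ_{b<(m−T)/p} C(m,T+(b+1)p)` — anchor 345 (B-cx) and (B-hom) over the field `ZMod p` on `α = Fin m`, and `Submodule.finrank_mono`. -/
theorem wilson_section_le {p c : ℕ} (hp : p.Prime) (hc : 0 < c) (hcp : c < p) (m T : ℕ) (hTc : T + c ≤ m) (hpT : p - c ≤ T)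
    (hlo : 2 * T ≤ m + (p - c)) (hhi : m ≤ 2 * T + c) :
    (∑ b ∈ Finset.range ((T + c) / p), m.choose (T + c - (b + 1) * p)) + m.choose (T + c) +
        ∑ b ∈ Finset.range ((m - (T + c)) / p), m.choose (T + c + (b + 1) * p) ≤
      (∑ b ∈ Finset.range (T / p), m.choose (T - (b + 1) * p)) + m.choose T +
        ∑ b ∈ Finset.range ((m - T) / p), m.choose (T + (b + 1) * p) := by
  haveI : Fact p.Prime := ⟨hp⟩
  have h1 := InclusionRankBetti.finrank_ker_add_eq (ZMod p) (α := Fin m) p hp hc hcp T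
    (by rw [Fintype.card_fin]; exact hTc) hpT (by rw [Fintype.card_fin]; exact hlo) (by rw [Fintype.card_fin]; exact hhi)
  have h2 := Submodule.finrank_mono (InclusionRankBetti.range_vecMulLinear_le_ker (ZMod p) (α := Fin m) p hp hc hcp T hpT)
  simp only [Fintype.card_fin] at h1
  omega

/-! ## §2 the census homology at `(c, J)`, `J = j + (p−c)(e+1)` -/

/-- **(CX-J)** PROBE 30 (CX-range) at `(a, b, J) = (p−c, c, j+(p−c)(e+1))`, typed on PROBE 29's matrix texts: over a field of prime
characteristic `p > c`, `rowspace M_(p−c)(j → J) ≤ leftker M_c(J → J+c(e+1))`. -/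
theorem range_le_ker (K : Type*) [Field K] (p : ℕ) [CharP K p] (hp : p.Prime) (k e c j : ℕ) (hcp : c < p) :
    LinearMap.range (Matrix.vecMulLinear
      (Matrix.of fun (v : {v : Fin k → Fin (e + 2) // (∑ i, (v i : ℕ)) + j = k * (e + 1)})
          (m : {v : Fin k → Fin (e + 2) // (∑ i, (v i : ℕ)) + (j + (p - c) * (e + 1)) = k * (e + 1)}) =>
        ((((List.flatMap (colR (e + 3)))^[p - c] [List.ofFn (fun i => (m.1 i : ℕ))]).count (List.ofFn (fun i => (v.1 i : ℕ))) : ℕ) : K))) ≤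
    LinearMap.ker (Matrix.vecMulLinear
      (Matrix.of fun (v : {v : Fin k → Fin (e + 2) // (∑ i, (v i : ℕ)) + (j + (p - c) * (e + 1)) = k * (e + 1)})
          (m : {m : Fin k → Fin (e + 2) // (∑ i, (m i : ℕ)) + (j + (p - c) * (e + 1) + c * (e + 1)) = k * (e + 1)}) =>
        ((((List.flatMap (colR (e + 3)))^[c] [List.ofFn (fun i => (m.1 i : ℕ))]).count (List.ofFn (fun i => (v.1 i : ℕ))) : ℕ) : K))) :=
  UnitColumnChain.range_le_ker_of_prime_le K p hp k e (p - c) c j (j + (p - c) * (e + 1)) (by omega)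

/-- the dimension shadow of (CX-J): `dim rowspace M_(p−c)(j → J) ≤ dim leftker M_c(J → J+c(e+1))`. -/
theorem finrank_range_le_finrank_ker (K : Type*) [Field K] (p : ℕ) [CharP K p] (hp : p.Prime) (k e c j : ℕ) (hcp : c < p) :
    Module.finrank K (LinearMap.range (Matrix.vecMulLinear
      (Matrix.of fun (v : {v : Fin k → Fin (e + 2) // (∑ i, (v i : ℕ)) + j = k * (e + 1)})
          (m : {v : Fin k → Fin (e + 2) // (∑ i, (v i : ℕ)) + (j + (p - c) * (e + 1)) = k * (e + 1)}) =>
        ((((List.flatMap (colR (e + 3)))^[p - c] [List.ofFn (fun i => (m.1 i : ℕ))]).count (List.ofFn (fun i => (v.1 i : ℕ))) : ℕ) : K)))) ≤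
    Module.finrank K (LinearMap.ker (Matrix.vecMulLinear
      (Matrix.of fun (v : {v : Fin k → Fin (e + 2) // (∑ i, (v i : ℕ)) + (j + (p - c) * (e + 1)) = k * (e + 1)})
          (m : {m : Fin k → Fin (e + 2) // (∑ i, (m i : ℕ)) + (j + (p - c) * (e + 1) + c * (e + 1)) = k * (e + 1)}) =>
        ((((List.flatMap (colR (e + 3)))^[c] [List.ofFn (fun i => (m.1 i : ℕ))]).count (List.ofFn (fun i => (v.1 i : ℕ))) : ℕ) : K)))) :=
  Submodule.finrank_mono (range_le_ker K p hp k e c j hcp)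

/-- **(HOM) THE DIMENSION LAW OF THE CENSUS HOMOLOGY.**  Over a field `K` of prime characteristic `p > c ≥ 1`, with
`H = leftker M_c(J→J+c(e+1)) ⧸ comap (subtype) (rowspace M_(p−c)(j→J))` (the rowspace as a submodule of the left kernel, (CX-J)):
`dim_K H + Σ_μ [feasible ∧ window] S_p(k−s, t+c) = Σ_μ [feasible ∧ window] S_p(k−s, t)` — PROBE 29's Betti law with the subquotient made
an honest module (`Submodule.finrank_quotient_add_finrank`, `Submodule.comapSubtypeEquivOfLe`). -/
theorem finrank_homology_add_eq (K : Type*) [Field K] (p : ℕ) [CharP K p] (hp : p.Prime) (k e c j : ℕ) (hc : 0 < c) (hcp : c < p) :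
    Module.finrank K (↥(LinearMap.ker (Matrix.vecMulLinear
      (Matrix.of fun (v : {v : Fin k → Fin (e + 2) // (∑ i, (v i : ℕ)) + (j + (p - c) * (e + 1)) = k * (e + 1)})
          (m : {m : Fin k → Fin (e + 2) // (∑ i, (m i : ℕ)) + (j + (p - c) * (e + 1) + c * (e + 1)) = k * (e + 1)}) =>
        ((((List.flatMap (colR (e + 3)))^[c] [List.ofFn (fun i => (m.1 i : ℕ))]).count (List.ofFn (fun i => (v.1 i : ℕ))) : ℕ) : K)))) ⧸
      Submodule.comap (LinearMap.ker (Matrix.vecMulLinear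
      (Matrix.of fun (v : {v : Fin k → Fin (e + 2) // (∑ i, (v i : ℕ)) + (j + (p - c) * (e + 1)) = k * (e + 1)})
          (m : {m : Fin k → Fin (e + 2) // (∑ i, (m i : ℕ)) + (j + (p - c) * (e + 1) + c * (e + 1)) = k * (e + 1)}) =>
        ((((List.flatMap (colR (e + 3)))^[c] [List.ofFn (fun i => (m.1 i : ℕ))]).count (List.ofFn (fun i => (v.1 i : ℕ))) : ℕ) : K)))).subtype
        (LinearMap.range (Matrix.vecMulLinear
      (Matrix.of fun (v : {v : Fin k → Fin (e + 2) // (∑ i, (v i : ℕ)) + j = k * (e + 1)})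
          (m : {v : Fin k → Fin (e + 2) // (∑ i, (v i : ℕ)) + (j + (p - c) * (e + 1)) = k * (e + 1)}) =>
        ((((List.flatMap (colR (e + 3)))^[p - c] [List.ofFn (fun i => (m.1 i : ℕ))]).count (List.ofFn (fun i => (v.1 i : ℕ))) : ℕ) : K))))) +
      ∑ μ : Fin k → Fin (e + 1),
        (if (e + 1) ∣ (j + (p - c) * (e + 1) + ∑ i, (μ i : ℕ)) ∧
          (e + 1) * (Finset.univ.filter (fun l => (μ l : ℕ) ≠ 0)).card ≤ j + (p - c) * (e + 1) + ∑ i, (μ i : ℕ) then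
          (if 2 * ((j + (p - c) * (e + 1) + ∑ i, (μ i : ℕ)) / (e + 1) - (Finset.univ.filter (fun l => (μ l : ℕ) ≠ 0)).card) ≤
              k - (Finset.univ.filter (fun l => (μ l : ℕ) ≠ 0)).card + (p - c) ∧
            k - (Finset.univ.filter (fun l => (μ l : ℕ) ≠ 0)).card <
              2 * ((j + (p - c) * (e + 1) + ∑ i, (μ i : ℕ)) / (e + 1) - (Finset.univ.filter (fun l => (μ l : ℕ) ≠ 0)).card) + c then
            ((∑ b ∈ Finset.range ((((j + (p - c) * (e + 1) + ∑ i, (μ i : ℕ)) / (e + 1) - (Finset.univ.filter (fun l => (μ l : ℕ) ≠ 0)).card) + c) / p),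
                (k - (Finset.univ.filter (fun l => (μ l : ℕ) ≠ 0)).card).choose
                  ((((j + (p - c) * (e + 1) + ∑ i, (μ i : ℕ)) / (e + 1) - (Finset.univ.filter (fun l => (μ l : ℕ) ≠ 0)).card) + c) - (b + 1) * p)) +
              (k - (Finset.univ.filter (fun l => (μ l : ℕ) ≠ 0)).card).choose
                (((j + (p - c) * (e + 1) + ∑ i, (μ i : ℕ)) / (e + 1) - (Finset.univ.filter (fun l => (μ l : ℕ) ≠ 0)).card) + c) +
              (∑ b ∈ Finset.range ((k - (Finset.univ.filter (fun l => (μ l : ℕ) ≠ 0)).card -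
                  (((j + (p - c) * (e + 1) + ∑ i, (μ i : ℕ)) / (e + 1) - (Finset.univ.filter (fun l => (μ l : ℕ) ≠ 0)).card) + c)) / p),
                (k - (Finset.univ.filter (fun l => (μ l : ℕ) ≠ 0)).card).choose
                  ((((j + (p - c) * (e + 1) + ∑ i, (μ i : ℕ)) / (e + 1) - (Finset.univ.filter (fun l => (μ l : ℕ) ≠ 0)).card) + c) + (b + 1) * p)))
          else 0)
        else 0) =
    ∑ μ : Fin k → Fin (e + 1),
        (if (e + 1) ∣ (j + (p - c) * (e + 1) + ∑ i, (μ i : ℕ)) ∧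
          (e + 1) * (Finset.univ.filter (fun l => (μ l : ℕ) ≠ 0)).card ≤ j + (p - c) * (e + 1) + ∑ i, (μ i : ℕ) then
          (if 2 * ((j + (p - c) * (e + 1) + ∑ i, (μ i : ℕ)) / (e + 1) - (Finset.univ.filter (fun l => (μ l : ℕ) ≠ 0)).card) ≤
              k - (Finset.univ.filter (fun l => (μ l : ℕ) ≠ 0)).card + (p - c) ∧
            k - (Finset.univ.filter (fun l => (μ l : ℕ) ≠ 0)).card <
              2 * ((j + (p - c) * (e + 1) + ∑ i, (μ i : ℕ)) / (e + 1) - (Finset.univ.filter (fun l => (μ l : ℕ) ≠ 0)).card) + c then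
            ((∑ b ∈ Finset.range (((j + (p - c) * (e + 1) + ∑ i, (μ i : ℕ)) / (e + 1) - (Finset.univ.filter (fun l => (μ l : ℕ) ≠ 0)).card) / p),
                (k - (Finset.univ.filter (fun l => (μ l : ℕ) ≠ 0)).card).choose
                  (((j + (p - c) * (e + 1) + ∑ i, (μ i : ℕ)) / (e + 1) - (Finset.univ.filter (fun l => (μ l : ℕ) ≠ 0)).card) - (b + 1) * p)) +
              (k - (Finset.univ.filter (fun l => (μ l : ℕ) ≠ 0)).card).choose
                ((j + (p - c) * (e + 1) + ∑ i, (μ i : ℕ)) / (e + 1) - (Finset.univ.filter (fun l => (μ l : ℕ) ≠ 0)).card) +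
              (∑ b ∈ Finset.range ((k - (Finset.univ.filter (fun l => (μ l : ℕ) ≠ 0)).card -
                  ((j + (p - c) * (e + 1) + ∑ i, (μ i : ℕ)) / (e + 1) - (Finset.univ.filter (fun l => (μ l : ℕ) ≠ 0)).card)) / p),
                (k - (Finset.univ.filter (fun l => (μ l : ℕ) ≠ 0)).card).choose
                  (((j + (p - c) * (e + 1) + ∑ i, (μ i : ℕ)) / (e + 1) - (Finset.univ.filter (fun l => (μ l : ℕ) ≠ 0)).card) + (b + 1) * p)))
          else 0)
        else 0) := by
  have h29 := UnitColumnBetti.finrank_ker_add_eq K p hp k e c j hc hcp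
  have hq := Submodule.finrank_quotient_add_finrank (Submodule.comap (LinearMap.ker (Matrix.vecMulLinear
      (Matrix.of fun (v : {v : Fin k → Fin (e + 2) // (∑ i, (v i : ℕ)) + (j + (p - c) * (e + 1)) = k * (e + 1)})
          (m : {m : Fin k → Fin (e + 2) // (∑ i, (m i : ℕ)) + (j + (p - c) * (e + 1) + c * (e + 1)) = k * (e + 1)}) =>
        ((((List.flatMap (colR (e + 3)))^[c] [List.ofFn (fun i => (m.1 i : ℕ))]).count (List.ofFn (fun i => (v.1 i : ℕ))) : ℕ) : K)))).subtype
    (LinearMap.range (Matrix.vecMulLinear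
      (Matrix.of fun (v : {v : Fin k → Fin (e + 2) // (∑ i, (v i : ℕ)) + j = k * (e + 1)})
          (m : {v : Fin k → Fin (e + 2) // (∑ i, (v i : ℕ)) + (j + (p - c) * (e + 1)) = k * (e + 1)}) =>
        ((((List.flatMap (colR (e + 3)))^[p - c] [List.ofFn (fun i => (m.1 i : ℕ))]).count (List.ofFn (fun i => (v.1 i : ℕ))) : ℕ) : K)))))
  rw [LinearEquiv.finrank_eq (Submodule.comapSubtypeEquivOfLe (range_le_ker K p hp k e c j hcp))] at hq
  omega

/-- **(EX-iff) THE EXACTNESS CRITERION.**  Over a field `K` of prime characteristic `p > c ≥ 1`: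
`rowspace M_(p−c)(j→J) = leftker M_c(J→J+c(e+1)) ↔ Σ_μ [feasible ∧ window] S_p(k−s,t+c) = Σ_μ [feasible ∧ window] S_p(k−s,t)` —
(CX-J), PROBE 29, `Submodule.eq_of_le_of_finrank_eq`; the converse through `LinearEquiv.ofEq`. -/
theorem range_eq_ker_iff (K : Type*) [Field K] (p : ℕ) [CharP K p] (hp : p.Prime) (k e c j : ℕ) (hc : 0 < c) (hcp : c < p) :
    LinearMap.range (Matrix.vecMulLinear
      (Matrix.of fun (v : {v : Fin k → Fin (e + 2) // (∑ i, (v i : ℕ)) + j = k * (e + 1)})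
          (m : {v : Fin k → Fin (e + 2) // (∑ i, (v i : ℕ)) + (j + (p - c) * (e + 1)) = k * (e + 1)}) =>
        ((((List.flatMap (colR (e + 3)))^[p - c] [List.ofFn (fun i => (m.1 i : ℕ))]).count (List.ofFn (fun i => (v.1 i : ℕ))) : ℕ) : K))) =
    LinearMap.ker (Matrix.vecMulLinear
      (Matrix.of fun (v : {v : Fin k → Fin (e + 2) // (∑ i, (v i : ℕ)) + (j + (p - c) * (e + 1)) = k * (e + 1)})
          (m : {m : Fin k → Fin (e + 2) // (∑ i, (m i : ℕ)) + (j + (p - c) * (e + 1) + c * (e + 1)) = k * (e + 1)}) =>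
        ((((List.flatMap (colR (e + 3)))^[c] [List.ofFn (fun i => (m.1 i : ℕ))]).count (List.ofFn (fun i => (v.1 i : ℕ))) : ℕ) : K))) ↔
    ∑ μ : Fin k → Fin (e + 1),
        (if (e + 1) ∣ (j + (p - c) * (e + 1) + ∑ i, (μ i : ℕ)) ∧
          (e + 1) * (Finset.univ.filter (fun l => (μ l : ℕ) ≠ 0)).card ≤ j + (p - c) * (e + 1) + ∑ i, (μ i : ℕ) then
          (if 2 * ((j + (p - c) * (e + 1) + ∑ i, (μ i : ℕ)) / (e + 1) - (Finset.univ.filter (fun l => (μ l : ℕ) ≠ 0)).card) ≤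
              k - (Finset.univ.filter (fun l => (μ l : ℕ) ≠ 0)).card + (p - c) ∧
            k - (Finset.univ.filter (fun l => (μ l : ℕ) ≠ 0)).card <
              2 * ((j + (p - c) * (e + 1) + ∑ i, (μ i : ℕ)) / (e + 1) - (Finset.univ.filter (fun l => (μ l : ℕ) ≠ 0)).card) + c then
            ((∑ b ∈ Finset.range ((((j + (p - c) * (e + 1) + ∑ i, (μ i : ℕ)) / (e + 1) - (Finset.univ.filter (fun l => (μ l : ℕ) ≠ 0)).card) + c) / p),
                (k - (Finset.univ.filter (fun l => (μ l : ℕ) ≠ 0)).card).choose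
                  ((((j + (p - c) * (e + 1) + ∑ i, (μ i : ℕ)) / (e + 1) - (Finset.univ.filter (fun l => (μ l : ℕ) ≠ 0)).card) + c) - (b + 1) * p)) +
              (k - (Finset.univ.filter (fun l => (μ l : ℕ) ≠ 0)).card).choose
                (((j + (p - c) * (e + 1) + ∑ i, (μ i : ℕ)) / (e + 1) - (Finset.univ.filter (fun l => (μ l : ℕ) ≠ 0)).card) + c) +
              (∑ b ∈ Finset.range ((k - (Finset.univ.filter (fun l => (μ l : ℕ) ≠ 0)).card -
                  (((j + (p - c) * (e + 1) + ∑ i, (μ i : ℕ)) / (e + 1) - (Finset.univ.filter (fun l => (μ l : ℕ) ≠ 0)).card) + c)) / p),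
                (k - (Finset.univ.filter (fun l => (μ l : ℕ) ≠ 0)).card).choose
                  ((((j + (p - c) * (e + 1) + ∑ i, (μ i : ℕ)) / (e + 1) - (Finset.univ.filter (fun l => (μ l : ℕ) ≠ 0)).card) + c) + (b + 1) * p)))
          else 0)
        else 0) =
    ∑ μ : Fin k → Fin (e + 1),
        (if (e + 1) ∣ (j + (p - c) * (e + 1) + ∑ i, (μ i : ℕ)) ∧
          (e + 1) * (Finset.univ.filter (fun l => (μ l : ℕ) ≠ 0)).card ≤ j + (p - c) * (e + 1) + ∑ i, (μ i : ℕ) then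
          (if 2 * ((j + (p - c) * (e + 1) + ∑ i, (μ i : ℕ)) / (e + 1) - (Finset.univ.filter (fun l => (μ l : ℕ) ≠ 0)).card) ≤
              k - (Finset.univ.filter (fun l => (μ l : ℕ) ≠ 0)).card + (p - c) ∧
            k - (Finset.univ.filter (fun l => (μ l : ℕ) ≠ 0)).card <
              2 * ((j + (p - c) * (e + 1) + ∑ i, (μ i : ℕ)) / (e + 1) - (Finset.univ.filter (fun l => (μ l : ℕ) ≠ 0)).card) + c then
            ((∑ b ∈ Finset.range (((j + (p - c) * (e + 1) + ∑ i, (μ i : ℕ)) / (e + 1) - (Finset.univ.filter (fun l => (μ l : ℕ) ≠ 0)).card) / p),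
                (k - (Finset.univ.filter (fun l => (μ l : ℕ) ≠ 0)).card).choose
                  (((j + (p - c) * (e + 1) + ∑ i, (μ i : ℕ)) / (e + 1) - (Finset.univ.filter (fun l => (μ l : ℕ) ≠ 0)).card) - (b + 1) * p)) +
              (k - (Finset.univ.filter (fun l => (μ l : ℕ) ≠ 0)).card).choose
                ((j + (p - c) * (e + 1) + ∑ i, (μ i : ℕ)) / (e + 1) - (Finset.univ.filter (fun l => (μ l : ℕ) ≠ 0)).card) +
              (∑ b ∈ Finset.range ((k - (Finset.univ.filter (fun l => (μ l : ℕ) ≠ 0)).card -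
                  ((j + (p - c) * (e + 1) + ∑ i, (μ i : ℕ)) / (e + 1) - (Finset.univ.filter (fun l => (μ l : ℕ) ≠ 0)).card)) / p),
                (k - (Finset.univ.filter (fun l => (μ l : ℕ) ≠ 0)).card).choose
                  (((j + (p - c) * (e + 1) + ∑ i, (μ i : ℕ)) / (e + 1) - (Finset.univ.filter (fun l => (μ l : ℕ) ≠ 0)).card) + (b + 1) * p)))
          else 0)
        else 0) := by
  have h29 := UnitColumnBetti.finrank_ker_add_eq K p hp k e c j hc hcp
  constructor
  · intro h
    have hf := LinearEquiv.finrank_eq (LinearEquiv.ofEq _ _ h)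
    omega
  · intro h
    exact Submodule.eq_of_le_of_finrank_eq (range_le_ker K p hp k e c j hcp) (by omega)

/-- **(EX-off) EXACTNESS OFF THE WINDOW BAND.**  Over a field `K` of prime characteristic `p > c ≥ 1`: if no feasible label
`μ : Fin k → Fin (e+1)` (`(e+1) ∣ J + Σμ`, `(e+1)·s ≤ J + Σμ`) has its block in the window `2t ≤ k−s+(p−c) ∧ k−s < 2t+c`
(`s = #{μ ≠ 0}`, `t = (J+Σμ)/(e+1) − s`), then the census ladder is EXACT at `J`: `rowspace M_(p−c)(j→J) = leftker M_c(J→J+c(e+1))`. -/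
theorem range_eq_ker_of_forall_not_window (K : Type*) [Field K] (p : ℕ) [CharP K p] (hp : p.Prime) (k e c j : ℕ) (hc : 0 < c)
    (hcp : c < p)
    (hoff : ∀ μ : Fin k → Fin (e + 1),
      ((e + 1) ∣ (j + (p - c) * (e + 1) + ∑ i, (μ i : ℕ)) ∧
          (e + 1) * (Finset.univ.filter (fun l => (μ l : ℕ) ≠ 0)).card ≤ j + (p - c) * (e + 1) + ∑ i, (μ i : ℕ)) →
      ¬ (2 * ((j + (p - c) * (e + 1) + ∑ i, (μ i : ℕ)) / (e + 1) - (Finset.univ.filter (fun l => (μ l : ℕ) ≠ 0)).card) ≤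
              k - (Finset.univ.filter (fun l => (μ l : ℕ) ≠ 0)).card + (p - c) ∧
            k - (Finset.univ.filter (fun l => (μ l : ℕ) ≠ 0)).card <
              2 * ((j + (p - c) * (e + 1) + ∑ i, (μ i : ℕ)) / (e + 1) - (Finset.univ.filter (fun l => (μ l : ℕ) ≠ 0)).card) + c)) :
    LinearMap.range (Matrix.vecMulLinear
      (Matrix.of fun (v : {v : Fin k → Fin (e + 2) // (∑ i, (v i : ℕ)) + j = k * (e + 1)})
          (m : {v : Fin k → Fin (e + 2) // (∑ i, (v i : ℕ)) + (j + (p - c) * (e + 1)) = k * (e + 1)}) =>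
        ((((List.flatMap (colR (e + 3)))^[p - c] [List.ofFn (fun i => (m.1 i : ℕ))]).count (List.ofFn (fun i => (v.1 i : ℕ))) : ℕ) : K))) =
    LinearMap.ker (Matrix.vecMulLinear
      (Matrix.of fun (v : {v : Fin k → Fin (e + 2) // (∑ i, (v i : ℕ)) + (j + (p - c) * (e + 1)) = k * (e + 1)})
          (m : {m : Fin k → Fin (e + 2) // (∑ i, (m i : ℕ)) + (j + (p - c) * (e + 1) + c * (e + 1)) = k * (e + 1)}) =>
        ((((List.flatMap (colR (e + 3)))^[c] [List.ofFn (fun i => (m.1 i : ℕ))]).count (List.ofFn (fun i => (v.1 i : ℕ))) : ℕ) : K))) := by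
  refine (range_eq_ker_iff K p hp k e c j hc hcp).mpr (Finset.sum_congr rfl (fun μ _ => ?_))
  split_ifs with hf hw
  · exact absurd hw (hoff μ hf)
  · rfl
  · rfl

/-! ## §3 (PD): Poincaré duality of the census homology, `dim H_(c)(J) = dim H_(p−c)(k(e+1) − J)` -/

/-- the monomials of complementary codegrees `J + J' = k(e+1)` are equinumerous (`v ↦ top − v`, PROBE 30 `degree_dual_add_degree`). -/
theorem card_level_eq_card_level (k e J J' : ℕ) (hJJ : J + J' = k * (e + 1)) :
    Fintype.card {v : Fin k → Fin (e + 2) // (∑ i, (v i : ℕ)) + J = k * (e + 1)} =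
    Fintype.card {v : Fin k → Fin (e + 2) // (∑ i, (v i : ℕ)) + J' = k * (e + 1)} := by
  refine Fintype.card_congr
    { toFun := fun v => ⟨fun l => Fin.rev (v.1 l), by have h := UnitColumnChain.degree_dual_add_degree v.1; have h' := v.2; dsimp only; omega⟩
      invFun := fun v => ⟨fun l => Fin.rev (v.1 l), by have h := UnitColumnChain.degree_dual_add_degree v.1; have h' := v.2; dsimp only; omega⟩
      left_inv := fun v => by ext l; simp only [Fin.rev_rev]
      right_inv := fun v => by ext l; simp only [Fin.rev_rev] }

/-- **(PD) POINCARÉ DUALITY OF THE CENSUS HOMOLOGY.**  Over a field `K` of prime characteristic `p > c` and for complementary levels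
`j + j' + p(e+1) = k(e+1)` (so that `J = j + (p−c)(e+1)` and `J' = j' + c(e+1)` satisfy `J + J' = k(e+1)`):
`dim_K ( leftker M_c(J → J+c(e+1)) ⧸ rowspace M_(p−c)(j → J) ) = dim_K ( leftker M_(p−c)(J' → J'+(p−c)(e+1)) ⧸ rowspace M_c(j' → J') )`
— the homology of `(q^(p−c), q^c)` at `J` and the homology of `(q^c, q^(p−c))` at the dual codegree have the same dimension.  Both
subquotients are honest ((CX-J) and PROBE 30 (CX-range) at `(a, b) = (c, p−c)`); rank–nullity, anchor 312 (SYM-F) `rank_levels_symm_field`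
twice (`rank M_c(J) = rank M_c(j')`, `rank M_(p−c)(j) = rank M_(p−c)(J')`) and `card_level_eq_card_level`. -/
theorem finrank_homology_eq_dual (K : Type*) [Field K] (p : ℕ) [CharP K p] (hp : p.Prime) (k e c j j' : ℕ) (hcp : c < p)
    (hjj : j + j' + p * (e + 1) = k * (e + 1)) :
    Module.finrank K (↥(LinearMap.ker (Matrix.vecMulLinear
      (Matrix.of fun (v : {v : Fin k → Fin (e + 2) // (∑ i, (v i : ℕ)) + (j + (p - c) * (e + 1)) = k * (e + 1)})
          (m : {m : Fin k → Fin (e + 2) // (∑ i, (m i : ℕ)) + (j + (p - c) * (e + 1) + c * (e + 1)) = k * (e + 1)}) =>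
        ((((List.flatMap (colR (e + 3)))^[c] [List.ofFn (fun i => (m.1 i : ℕ))]).count (List.ofFn (fun i => (v.1 i : ℕ))) : ℕ) : K)))) ⧸
      Submodule.comap (LinearMap.ker (Matrix.vecMulLinear
      (Matrix.of fun (v : {v : Fin k → Fin (e + 2) // (∑ i, (v i : ℕ)) + (j + (p - c) * (e + 1)) = k * (e + 1)})
          (m : {m : Fin k → Fin (e + 2) // (∑ i, (m i : ℕ)) + (j + (p - c) * (e + 1) + c * (e + 1)) = k * (e + 1)}) =>
        ((((List.flatMap (colR (e + 3)))^[c] [List.ofFn (fun i => (m.1 i : ℕ))]).count (List.ofFn (fun i => (v.1 i : ℕ))) : ℕ) : K)))).subtype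
        (LinearMap.range (Matrix.vecMulLinear
      (Matrix.of fun (v : {v : Fin k → Fin (e + 2) // (∑ i, (v i : ℕ)) + j = k * (e + 1)})
          (m : {v : Fin k → Fin (e + 2) // (∑ i, (v i : ℕ)) + (j + (p - c) * (e + 1)) = k * (e + 1)}) =>
        ((((List.flatMap (colR (e + 3)))^[p - c] [List.ofFn (fun i => (m.1 i : ℕ))]).count (List.ofFn (fun i => (v.1 i : ℕ))) : ℕ) : K))))) =
    Module.finrank K (↥(LinearMap.ker (Matrix.vecMulLinear
      (Matrix.of fun (v : {v : Fin k → Fin (e + 2) // (∑ i, (v i : ℕ)) + (j' + c * (e + 1)) = k * (e + 1)})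
          (m : {m : Fin k → Fin (e + 2) // (∑ i, (m i : ℕ)) + (j' + c * (e + 1) + (p - c) * (e + 1)) = k * (e + 1)}) =>
        ((((List.flatMap (colR (e + 3)))^[p - c] [List.ofFn (fun i => (m.1 i : ℕ))]).count (List.ofFn (fun i => (v.1 i : ℕ))) : ℕ) : K)))) ⧸
      Submodule.comap (LinearMap.ker (Matrix.vecMulLinear
      (Matrix.of fun (v : {v : Fin k → Fin (e + 2) // (∑ i, (v i : ℕ)) + (j' + c * (e + 1)) = k * (e + 1)})
          (m : {m : Fin k → Fin (e + 2) // (∑ i, (m i : ℕ)) + (j' + c * (e + 1) + (p - c) * (e + 1)) = k * (e + 1)}) =>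
        ((((List.flatMap (colR (e + 3)))^[p - c] [List.ofFn (fun i => (m.1 i : ℕ))]).count (List.ofFn (fun i => (v.1 i : ℕ))) : ℕ) : K)))).subtype
        (LinearMap.range (Matrix.vecMulLinear
      (Matrix.of fun (v : {v : Fin k → Fin (e + 2) // (∑ i, (v i : ℕ)) + j' = k * (e + 1)})
          (m : {m : Fin k → Fin (e + 2) // (∑ i, (m i : ℕ)) + (j' + c * (e + 1)) = k * (e + 1)}) =>
        ((((List.flatMap (colR (e + 3)))^[c] [List.ofFn (fun i => (m.1 i : ℕ))]).count (List.ofFn (fun i => (v.1 i : ℕ))) : ℕ) : K))))) := by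
  have hCP : c * (e + 1) ≤ p * (e + 1) := Nat.mul_le_mul_right _ hcp.le
  have hPK : p * (e + 1) ≤ k * (e + 1) := by omega
  -- the two containments (PROBE 30)
  have hle := range_le_ker K p hp k e c j hcp
  have hle' := UnitColumnChain.range_le_ker_of_prime_le K p hp k e c (p - c) j' (j' + c * (e + 1)) (by omega)
  -- quotient dimensions
  have hq := Submodule.finrank_quotient_add_finrank (Submodule.comap (LinearMap.ker (Matrix.vecMulLinear
      (Matrix.of fun (v : {v : Fin k → Fin (e + 2) // (∑ i, (v i : ℕ)) + (j + (p - c) * (e + 1)) = k * (e + 1)})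
          (m : {m : Fin k → Fin (e + 2) // (∑ i, (m i : ℕ)) + (j + (p - c) * (e + 1) + c * (e + 1)) = k * (e + 1)}) =>
        ((((List.flatMap (colR (e + 3)))^[c] [List.ofFn (fun i => (m.1 i : ℕ))]).count (List.ofFn (fun i => (v.1 i : ℕ))) : ℕ) : K)))).subtype
    (LinearMap.range (Matrix.vecMulLinear
      (Matrix.of fun (v : {v : Fin k → Fin (e + 2) // (∑ i, (v i : ℕ)) + j = k * (e + 1)})
          (m : {v : Fin k → Fin (e + 2) // (∑ i, (v i : ℕ)) + (j + (p - c) * (e + 1)) = k * (e + 1)}) =>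
        ((((List.flatMap (colR (e + 3)))^[p - c] [List.ofFn (fun i => (m.1 i : ℕ))]).count (List.ofFn (fun i => (v.1 i : ℕ))) : ℕ) : K)))))
  rw [LinearEquiv.finrank_eq (Submodule.comapSubtypeEquivOfLe hle)] at hq
  have hq' := Submodule.finrank_quotient_add_finrank (Submodule.comap (LinearMap.ker (Matrix.vecMulLinear
      (Matrix.of fun (v : {v : Fin k → Fin (e + 2) // (∑ i, (v i : ℕ)) + (j' + c * (e + 1)) = k * (e + 1)})
          (m : {m : Fin k → Fin (e + 2) // (∑ i, (m i : ℕ)) + (j' + c * (e + 1) + (p - c) * (e + 1)) = k * (e + 1)}) =>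
        ((((List.flatMap (colR (e + 3)))^[p - c] [List.ofFn (fun i => (m.1 i : ℕ))]).count (List.ofFn (fun i => (v.1 i : ℕ))) : ℕ) : K)))).subtype
        (LinearMap.range (Matrix.vecMulLinear
      (Matrix.of fun (v : {v : Fin k → Fin (e + 2) // (∑ i, (v i : ℕ)) + j' = k * (e + 1)})
          (m : {m : Fin k → Fin (e + 2) // (∑ i, (m i : ℕ)) + (j' + c * (e + 1)) = k * (e + 1)}) =>
        ((((List.flatMap (colR (e + 3)))^[c] [List.ofFn (fun i => (m.1 i : ℕ))]).count (List.ofFn (fun i => (v.1 i : ℕ))) : ℕ) : K)))))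
  rw [LinearEquiv.finrank_eq (Submodule.comapSubtypeEquivOfLe hle')] at hq'
  -- rank–nullity at `J` and at `J'`, ranges as ranks
  have hn := LinearMap.finrank_range_add_finrank_ker (Matrix.vecMulLinear
      (Matrix.of fun (v : {v : Fin k → Fin (e + 2) // (∑ i, (v i : ℕ)) + (j + (p - c) * (e + 1)) = k * (e + 1)})
          (m : {m : Fin k → Fin (e + 2) // (∑ i, (m i : ℕ)) + (j + (p - c) * (e + 1) + c * (e + 1)) = k * (e + 1)}) =>
        ((((List.flatMap (colR (e + 3)))^[c] [List.ofFn (fun i => (m.1 i : ℕ))]).count (List.ofFn (fun i => (v.1 i : ℕ))) : ℕ) : K)))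
  have hn' := LinearMap.finrank_range_add_finrank_ker (Matrix.vecMulLinear
      (Matrix.of fun (v : {v : Fin k → Fin (e + 2) // (∑ i, (v i : ℕ)) + (j' + c * (e + 1)) = k * (e + 1)})
          (m : {m : Fin k → Fin (e + 2) // (∑ i, (m i : ℕ)) + (j' + c * (e + 1) + (p - c) * (e + 1)) = k * (e + 1)}) =>
        ((((List.flatMap (colR (e + 3)))^[p - c] [List.ofFn (fun i => (m.1 i : ℕ))]).count (List.ofFn (fun i => (v.1 i : ℕ))) : ℕ) : K)))
  rw [Module.finrank_fintype_fun_eq_card, UnitColumnBetti.finrank_range_vecMulLinear_eq_rank] at hn hn'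
  rw [UnitColumnBetti.finrank_range_vecMulLinear_eq_rank] at hq hq'
  -- level symmetry of the two ranks (anchor 312) and of the two cardinalities
  have hr1 := UnitColumnRankLevelSymmetry.rank_levels_symm_field K k e c (j + (p - c) * (e + 1)) j'
    (by rw [Nat.sub_mul, Nat.sub_mul]; omega)
  have hr2 := UnitColumnRankLevelSymmetry.rank_levels_symm_field K k e (p - c) j (j' + c * (e + 1))
    (by rw [Nat.sub_mul, Nat.sub_mul]; omega)
  have hcard := card_level_eq_card_level k e (j + (p - c) * (e + 1)) (j' + c * (e + 1)) (by rw [Nat.sub_mul]; omega)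
  omega

end Summit.HodgeConjecture.HodgeConjecture.HodgeLocus.Census.UnitColumnHomology
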